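import Summits.RiemannHypothesis.RiemannHypothesis.Theorems.JensenLogBandRealnessLadder
import HarnessLib

/-!
# Realness climbs the derivative ladder of `ξ₁` (II): the BAND follows from the TOP SHELL (RH-FREE)

Cell rh-jensen, LADDER-RH rung J-P(P3) «log band» (route JensenLogBand); bears_on: J-P(P3) crux
`XiDerivBandRealAllRates` (stmt-RiemannHypothesis-19913); seat rh-jensen-idea-2 g7 (negation-construct
lens, round 7). Second file of «realness climbs the derivative ladder»
(`…Theorems.JensenLogBandRealnessLadder`: `exists_nonreal_ancestor`, `im_eq_zero_of_level_real`,
`edgeReal_of_bandReal`). ROUTE-INDEPENDENT (no `Theses` import; the route-vocabulary corollaries are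
`…Theorems.JensenLogBandOneCrux`). RH-FREE. WHAT THIS IS NOT: nothing here bears on the zeros of `ζ`
or the truth of RH, and nothing here proves any realness by itself — it is a REDUCTION of the zone in
which the u-arc dominance must be proved.

## BAND ⇐ TOP SHELL (`bandReal_of_shellReal`, `allReal_below_exp_of_shellReal`)

For `‖w‖ = X ≥ (n/log n)²/64` and `n` large, `Δ ≤ X/2`; the level `k = ⌊log(3X/2)/c⌋ + 1` has
`e^{c(k−1)} ≤ 3X/2 < e^{ck}`, so its TOP SHELL `[e^{c(k−1)}/4, e^{ck})` contains
`[X/2, 3X/2] ⊇ [X − Δ, X + Δ]`, and `k₁ ≤ k ≤ n` whenever `X < e^{c'n}`, `c' < c`. Hence realness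
of the zeros of `ξ₁⁽ᵏ⁾` in the shells `e^{c(k−1)}/4 ≤ ‖z‖ < e^{ck}` (all `k ≥ k₁`) gives, for every
`c' < c`, realness of all zeros of `ξ₁⁽ⁿ⁾` with `(n/log n)²/64 ≤ ‖z‖ < e^{c'n}` (`n` large), and
with the tree floor (`EffectiveKimLee`, `n ≥ 20 000`) of ALL zeros of modulus `< e^{c'n}`. In the
`u`-plane the shell is the height range `T ∈ [e^{c(k−1)/2}/2, e^{ck/2})`, on which the arc radius
`h = 2(k+1)/log(T/2π) = (4/c)(1 + O(1/k))`: the u-arc dominance is needed ONLY in the single-limit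
regime `T → ∞, h → 4/c` — not uniformly down to `h = T/4`, and never at the edge.
-/

set_option linter.dupNamespace false

noncomputable section

open Complex Filter Metric Set Topology
open scoped ComplexConjugate

namespace Summit.RiemannHypothesis.RiemannHypothesis.Theorems.JensenPolynomials.LogBand.BandOfShell

open Literature.NumberTheory.LFunctions
  Summit.RiemannHypothesis.RiemannHypothesis.Theorems.JensenPolynomials
  Summit.RiemannHypothesis.RiemannHypothesis.Theorems.JensenPolynomials.EffectiveKimLee
  Summit.RiemannHypothesis.RiemannHypothesis.Theorems.JensenPolynomials.LogBand.RealnessLadder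

/-- Eventual real-arithmetic facts used in `bandReal_of_shellReal`. -/
theorem eventually_bandOfShell_ineq {c c' : ℝ} (hc' : 0 < c') (hcc : c' < c) (k₁ : ℕ) :
    ∀ᶠ n : ℕ in atTop, 1 ≤ Real.log n ∧ 4096 * Real.log n ^ 2 ≤ n ∧
      Real.exp (c * k₁) ≤ 64 * (n : ℝ) ∧ Real.log (3 / 2) + c ≤ (c - c') * n := by
  have hc : 0 < c := hc'.trans hcc
  have hlog : Tendsto (fun n : ℕ => Real.log (n : ℝ)) atTop atTop :=
    Real.tendsto_log_atTop.comp tendsto_natCast_atTop_atTop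
  have E1 : ∀ᶠ n : ℕ in atTop, (1 : ℝ) ≤ Real.log n := hlog.eventually_ge_atTop _
  have E2 : ∀ᶠ n : ℕ in atTop, Real.log n ^ 2 ≤ 1 / 4096 * (n : ℝ) := by
    have h := ((Real.isLittleO_pow_log_id_atTop (n := 2)).comp_tendsto
      tendsto_natCast_atTop_atTop).bound (show (0 : ℝ) < 1 / 4096 by positivity)
    filter_upwards [h] with n hn
    have hn0 : (0 : ℝ) ≤ n := Nat.cast_nonneg n
    simp only [Function.comp, id, Real.norm_eq_abs, abs_of_nonneg hn0] at hn
    exact (le_abs_self _).trans hn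
  have E3 : ∀ᶠ n : ℕ in atTop, Real.exp (c * k₁) / 64 ≤ (n : ℝ) :=
    tendsto_natCast_atTop_atTop.eventually_ge_atTop _
  have E4 : ∀ᶠ n : ℕ in atTop, (Real.log (3 / 2) + c) / (c - c') ≤ (n : ℝ) :=
    tendsto_natCast_atTop_atTop.eventually_ge_atTop _
  filter_upwards [E1, E2, E3, E4] with n h1 h2 h3 h4
  refine ⟨h1, by linarith, by linarith, ?_⟩
  have h5 := (div_le_iff₀ (show (0 : ℝ) < c - c' by linarith)).1 h4
  linarith [h5, mul_comm (n : ℝ) (c - c')]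

/-- **SHELL ⇒ BAND (RH-FREE reduction).** Let `0 < c' < c`. If for all `k ≥ k₁` every zero of
`ξ₁⁽ᵏ⁾` in the TOP SHELL `e^{c(k−1)}/4 ≤ ‖z‖ < e^{ck}` is real, then from some `n₁` on every zero of
`ξ₁⁽ⁿ⁾` with `(n/log n)²/64 ≤ ‖z‖ < e^{c'n}` is real. (Window form of the ladder lemma at the level
`k = ⌊log(3‖z‖/2)/c⌋ + 1`.) -/
theorem bandReal_of_shellReal {c c' : ℝ} (hc' : 0 < c') (hcc : c' < c) {k₁ : ℕ}
    (hS : ∀ k : ℕ, k₁ ≤ k → ∀ z : ℂ, iteratedDeriv k xiSq z = 0 →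
      Real.exp (c * ((k : ℝ) - 1)) / 4 ≤ ‖z‖ → ‖z‖ < Real.exp (c * (k : ℝ)) → z.im = 0) :
    ∃ n₁ : ℕ, ∀ n : ℕ, n₁ ≤ n → ∀ z : ℂ, iteratedDeriv n xiSq z = 0 →
      chainRadius n ≤ ‖z‖ → ‖z‖ < Real.exp (c' * (n : ℝ)) → z.im = 0 := by
  have hc : 0 < c := hc'.trans hcc
  obtain ⟨n₁, hn₁⟩ := Filter.eventually_atTop.1 (eventually_bandOfShell_ineq hc' hcc k₁)
  refine ⟨n₁, fun n hn z hz hlo hhi => ?_⟩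
  obtain ⟨hL1, hL2, hk1n, hcn⟩ := hn₁ n hn
  have hn0 : (0 : ℝ) < n := by
    by_contra h
    rw [not_lt] at h
    have : (n : ℝ) = 0 := le_antisymm h (Nat.cast_nonneg n)
    rw [this, Real.log_zero] at hL1
    linarith
  have hn1 : (1 : ℝ) ≤ n := by
    have : (1 : ℕ) ≤ n := by exact_mod_cast hn0
    exact_mod_cast this
  set L : ℝ := Real.log n with hL
  have hL0 : 0 < L := by linarith
  set X : ℝ := ‖z‖ with hX
  -- `X ≥ (n/L)²/64 ≥ 64 n`
  have hX0 : 64 * (n : ℝ) ≤ X := by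
    have h1 : 64 * (n : ℝ) ≤ ((n : ℝ) / L) ^ 2 / 64 := by
      rw [div_pow, le_div_iff₀ (by norm_num : (0 : ℝ) < 64), div_eq_mul_inv,
        ← div_eq_mul_inv, le_div_iff₀ (by positivity)]
      nlinarith
    have h2 : chainRadius n = ((n : ℝ) / L) ^ 2 / 64 := rfl
    linarith
  have hXpos : 0 < X := by linarith
  -- the fuzz `Δ ≤ X/2`
  have hsq : Real.sqrt (n : ℝ) ^ 2 = n := Real.sq_sqrt hn0.le
  have hsqX : Real.sqrt X ^ 2 = X := Real.sq_sqrt hXpos.le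
  have hsqrt1 : 1 ≤ Real.sqrt (n : ℝ) := by
    rw [show (1 : ℝ) = Real.sqrt 1 by simp]; exact Real.sqrt_le_sqrt hn1
  have h8 : 8 * Real.sqrt (n : ℝ) ≤ Real.sqrt X := by
    have : Real.sqrt (64 * (n : ℝ)) ≤ Real.sqrt X := Real.sqrt_le_sqrt hX0
    rwa [show (64 : ℝ) * n = 8 ^ 2 * n by norm_num, Real.sqrt_mul' _ hn0.le,
      Real.sqrt_sq (by norm_num : (0 : ℝ) ≤ 8)] at this
  have hΔ : (1 + Real.sqrt n) * (1 + Real.sqrt n + Real.sqrt X) ≤ X / 2 := by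
    have h1 : 1 + Real.sqrt (n : ℝ) ≤ 2 * Real.sqrt n := by linarith
    have h2 : (1 + Real.sqrt (n : ℝ)) ^ 2 ≤ 4 * n := by nlinarith
    have h3 : (1 + Real.sqrt (n : ℝ)) * Real.sqrt X ≤ X / 4 := by
      calc (1 + Real.sqrt (n : ℝ)) * Real.sqrt X ≤ (Real.sqrt X / 4) * Real.sqrt X :=
            mul_le_mul_of_nonneg_right (by linarith) (Real.sqrt_nonneg _)
        _ = X / 4 := by rw [div_mul_eq_mul_div, ← sq, hsqX]
    nlinarith
  -- the level `k = ⌊y⌋ + 1`, `y = log(3X/2)/c`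
  set y : ℝ := Real.log (3 / 2 * X) / c with hy
  have h32 : (1 : ℝ) ≤ 3 / 2 * X := by linarith
  have hy0 : 0 ≤ y := div_nonneg (Real.log_nonneg h32) hc.le
  set k : ℕ := ⌊y⌋₊ + 1 with hk
  have hkR : (k : ℝ) = ⌊y⌋₊ + 1 := by rw [hk]; push_cast; ring
  have hfl : (⌊y⌋₊ : ℝ) ≤ y := Nat.floor_le hy0
  have hlt : y < (⌊y⌋₊ : ℝ) + 1 := Nat.lt_floor_add_one y
  -- `e^{c(k-1)} ≤ 3X/2 < e^{ck}`
  have hexp_lo : Real.exp (c * ((k : ℝ) - 1)) ≤ 3 / 2 * X := by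
    have h1 : c * ((k : ℝ) - 1) ≤ Real.log (3 / 2 * X) := by
      rw [hkR, add_sub_cancel_right]
      have := mul_le_mul_of_nonneg_left hfl hc.le
      rwa [hy, mul_div_cancel₀ _ hc.ne'] at this
    calc Real.exp (c * ((k : ℝ) - 1)) ≤ Real.exp (Real.log (3 / 2 * X)) := Real.exp_le_exp.2 h1
      _ = 3 / 2 * X := Real.exp_log (by linarith)
  have hexp_hi : 3 / 2 * X < Real.exp (c * (k : ℝ)) := by
    have h1 : Real.log (3 / 2 * X) < c * (k : ℝ) := by
      rw [hkR]
      have := mul_lt_mul_of_pos_left hlt hc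
      rwa [hy, mul_div_cancel₀ _ hc.ne'] at this
    calc 3 / 2 * X = Real.exp (Real.log (3 / 2 * X)) := (Real.exp_log (by linarith)).symm
      _ < Real.exp (c * (k : ℝ)) := Real.exp_lt_exp.2 h1
  -- `k₁ ≤ k`
  have hk₁ : k₁ ≤ k := by
    have h1 : c * (k₁ : ℝ) ≤ Real.log (3 / 2 * X) := by
      rw [Real.le_log_iff_exp_le (by linarith)]; linarith
    have h2 : (k₁ : ℝ) ≤ y := by
      rw [hy, le_div_iff₀ hc]; linarith
    have h3 : (k₁ : ℝ) < k := by rw [hkR]; linarith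
    exact_mod_cast h3.le
  -- `k ≤ n`
  have hkn : k ≤ n := by
    have h1 : Real.log (3 / 2 * X) < Real.log (3 / 2) + c' * n := by
      have : Real.log (3 / 2 * X) = Real.log (3 / 2) + Real.log X :=
        Real.log_mul (by norm_num) hXpos.ne'
      rw [this]
      have hX' : Real.log X < c' * n := by
        rw [Real.log_lt_iff_lt_exp hXpos]; exact hhi
      linarith
    have h2 : y ≤ (n : ℝ) - 1 := by
      rw [hy, div_le_iff₀ hc]; nlinarith
    have h3 : (k : ℝ) ≤ n := by rw [hkR]; linarith
    exact_mod_cast h3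
  -- apply the window form at level `k`
  refine im_eq_zero_of_level_real n k hkn hz fun v hv hvlo hvhi => hS k hk₁ v hv ?_ ?_
  · -- `e^{c(k-1)}/4 ≤ X/2 ≤ X - Δ ≤ ‖v‖`
    have : X / 2 ≤ ‖v‖ := by rw [hX] at hΔ ⊢; linarith
    linarith
  · -- `‖v‖ ≤ X + Δ ≤ 3X/2 < e^{ck}`
    have : ‖v‖ ≤ 3 / 2 * X := by rw [hX] at hΔ ⊢; linarith
    linarith

/-- **SHELL at one rate gives the whole log band below it (RH-FREE).** With the tree floor
(`EffectiveKimLee.xiSq_derivZeros_real_below_of_le`, `n ≥ 20 000`): if for all `k ≥ k₁` the zeros of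
`ξ₁⁽ᵏ⁾` in the shell `e^{c(k−1)}/4 ≤ ‖z‖ < e^{ck}` are real, then for every `0 < c' < c`, from some
`n₁` on, EVERY zero of `ξ₁⁽ⁿ⁾` of modulus `< e^{c'n}` is real. -/
theorem allReal_below_exp_of_shellReal {c c' : ℝ} (hc' : 0 < c') (hcc : c' < c) {k₁ : ℕ}
    (hS : ∀ k : ℕ, k₁ ≤ k → ∀ z : ℂ, iteratedDeriv k xiSq z = 0 →
      Real.exp (c * ((k : ℝ) - 1)) / 4 ≤ ‖z‖ → ‖z‖ < Real.exp (c * (k : ℝ)) → z.im = 0) :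
    ∃ n₁ : ℕ, ∀ n : ℕ, n₁ ≤ n → ∀ z : ℂ, iteratedDeriv n xiSq z = 0 →
      ‖z‖ < Real.exp (c' * (n : ℝ)) → z.im = 0 := by
  obtain ⟨n₁, hn₁⟩ := bandReal_of_shellReal hc' hcc hS
  refine ⟨max n₁ 20000, fun n hn z hz hhi => ?_⟩
  rcases le_or_gt (chainRadius n) ‖z‖ with hlo | hlt
  · exact hn₁ n (le_trans (le_max_left _ _) hn) z hz hlo hhi
  · refine xiSq_derivZeros_real_below_of_le n (le_trans (le_max_right _ _) hn) z hz ?_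
    have : chainRadius n = 1 / 64 * ((n : ℝ) / Real.log n) ^ 2 := by
      show ((n : ℝ) / Real.log n) ^ 2 / 64 = _; ring
    linarith

end Summit.RiemannHypothesis.RiemannHypothesis.Theorems.JensenPolynomials.LogBand.BandOfShell

end
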